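import Literature.Analysis.Asymptotics.LaplaceMethodCompactGroupSmooth
import Mathlib.Analysis.Complex.RealDeriv
import Mathlib.LinearAlgebra.Matrix.PosDef
import HarnessLib

/-!
# The one-link ∕ one-plaquette Wilson weight `e^{−β Re tr(1 − U)} dU` concentrates at `U = 1` as `β → ∞`

[STATUS: formal-restatement] [support] [H3] [topic MathematicalPhysics/QuantumFieldTheory]

A WORKED INSTANCE of the compact-group Laplace method of
`Literature.Analysis.Asymptotics.LaplaceMethodCompactGroupSmooth` (`tendsto_gibbs_expectation_haar_of_contDiffAt`:
concentration of `e^{−βf} dμ_Haar ∕ Z_β` at a unique minimum that is `C²` with positive line second variations in the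
tree's exponential chart `Θ = IsChartRep.expChart` of Bałaban's files) for THE simplest lattice-gauge exponent,
Chatterjee's one-plaquette cost `φ(U) = Re tr(I − U)` [Chatterjee 2016, (2.1)]:

* §1 Hilbert–Schmidt geometry, norm-free and for an arbitrary finite index type (the tree's
  `UnitaryCayley.re_trace_one_sub` ∕ `OneLinkLaplace.re_trace_eq_of_mem_unitaryGroup` are the `Fin N`, Frobenius-norm
  phrasings): `0 < Re tr(AᴴA)` for `A ≠ 0`; **Lemma 7.2** `N − Re tr U = ½ Re tr((1 − U)ᴴ(1 − U))` on `U(N)`, hence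
  `N − Re tr U > 0` for unitary `U ≠ 1` — the cost has the UNIQUE minimiser `U = 1`.
* §2 Calculus of `t ↦ tr e^{tX}` (Hall Prop. 2.4 `d/dt e^{tX} = Xe^{tX}`, Prop. 2.16 `exp ∈ C^∞(M_N(ℂ))`):
  `hasDerivAt_trace_exp_smul`, `hasDerivAt_trace_mul_exp_smul`, the line second variation
  `d²/dt²|₀ (c − Re tr e^{tX}) = −Re tr(X²)` (`iteratedDeriv_two_const_sub_re_trace_exp`), which for skew-Hermitian `X`
  is `Re tr(XᴴX) = ‖X‖²_HS > 0` (`iteratedDeriv_two_const_sub_re_trace_exp_of_skew`), and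
  `M ↦ Re tr e^{M} ∈ C²` (`contDiff_re_trace_exp`).
* §3 ★ `tendsto_gibbs_expectation_wilsonLink`: for EVERY compact group `G` faithfully represented by `ρ` onto a
  log-charted closed subgroup of `U(N)` whose Lie algebra consists of skew-Hermitian matrices (`h : IsChartRep C ρ`,
  `𝔤` `ad`-stable), every Haar measure `μ` and every continuous `ψ`,
  `∫ e^{−β(N − Re tr ρ(g))} ψ(g) dμ ∕ ∫ e^{−β(N − Re tr ρ(g))} dμ ⟶ ψ(1)` (`β → ∞`).
  Proof = the three hypotheses of `tendsto_gibbs_expectation_haar_of_contDiffAt`, discharged by §1 (unique minimum),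
  §2 (`C²` in the chart via `ρ(Θ X) = e^X`, `IsChartRep.rho_expChart`; line second variation `‖X‖²_HS > 0`), with the
  Borel structure `borel 𝔤` and a Euclidean frame `EuclideanSpace ℝ (Fin (dim 𝔤)) ≃L[ℝ] 𝔤` chosen inside the proof.
* §4 the instances ★ `tendsto_gibbs_expectation_wilsonLink_specialUnitaryGroup` (`SU(N)`, every `N ≥ 1`) and
  ★ `tendsto_gibbs_expectation_wilsonLink_unitaryGroup` (`U(N)`): `⟨ψ⟩_β → ψ(1)` for the one-link ∕ one-plaquette
  law `e^{−β(N − Re tr U)} dU ∕ Z_β` — the `β → ∞` (weak-coupling, `β = 1∕g₀²`) limit of the single-plaquette model.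

HONEST SCOPE.  One compact group integral, `β → ∞` at everything else fixed: the zero-temperature ∕ tree-level limit
of a single-link (single-plaquette) Wilson weight.  Nothing here is uniform in a volume, nothing is about `d = 4`
lattice Yang–Mills beyond one plaquette, the twisted slab (`T1`), `IRcof` ∕ `IR`, or the Yang–Mills mass gap (Clay),
which is NOT proved; `R4` closes only the conditional finite-`𝕋⁴` rung `BalabanLadder.UV`.  The quantitative,
word-uniform one-link Laplace CONCENTRATION (variance `O(Lip²∕s)`) is the tree's
`OneLinkLaplaceConcentration_holds` (`PinnedOneLinkLaplaceProofs`); the present file is the qualitative `β → ∞`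
statement for continuous observables, reached through the general compact-group theorem.  0 definitions, 0 named
facts.

## References
* S. Chatterjee, *The leading term of the Yang–Mills free energy*, J. Funct. Anal. 271 (2016) 2944–3005 =
  arXiv:1602.01222: (2.1) `φ(U) = Re tr(I − U)` (corpus `paper:arxiv-1602.01222` p0004 L8); §6, the Hilbert–Schmidt
  norm `‖M‖² = Σ|m_ij|² = tr(M*M)` (p0011 L3–6); Lemma 7.2 `φ(U) = ½‖I − U‖²` (p0013 L14–19); Lemma 16.1 (quadratic
  approximation of `e^{iH}`, p0025 L44–49). [Chatterjee2016]
* B. C. Hall, *Lie Groups, Lie Algebras, and Representations*, 2nd ed., GTM 222 (2015): Prop. 2.4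
  `d/dt e^{tX} = Xe^{tX} = e^{tX}X` (corpus `book:hall2015-…` p0043 L20–26); Prop. 2.16 (`exp` is `C^∞` on `M_n(ℂ)`,
  p0048 L43). [Hall2015]
* K. W. Breitung, *Asymptotic Approximations for Probability Integrals*, LNM 1592 (1994), Ch. 5 Thm. 41 p. 56. [Breitung1994]
* S. Helgason, *Groups and Geometric Analysis*, AMS (2000), Ch. I §1 Thm. 1.14 (13) p. 96. [Helgason2000]
* C.-R. Hwang, *Laplace's method revisited: weak convergence of probability measures*, Ann. Probab. 8 (1980)
  1177–1182, main theorem. [Hwang1980]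
-/

noncomputable section

open MeasureTheory Filter Topology NormedSpace
open scoped ComplexOrder Matrix Matrix.Norms.L2Operator

namespace Literature.MathematicalPhysics.QuantumFieldTheory.OneLinkWeakCoupling

open Literature.MathematicalPhysics.QuantumFieldTheory.Balaban1983to89
open Literature.MathematicalPhysics.QuantumFieldTheory.Balaban1983to89.HaarExponentialChart
open Literature.MathematicalPhysics.QuantumLattice (fundamentalRep unitaryFundamentalRep fundamentalRep_apply
  unitaryFundamentalRep_apply)
open Literature.Analysis.Asymptotics

variable {n : Type*} [Fintype n] [DecidableEq n]

/-! ## §1 Hilbert–Schmidt geometry of `U(N)`: the cost `N − Re tr U` and its unique minimum -/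

omit [DecidableEq n] in
/-- `0 < Re tr(AᴴA) = Σ_{ij}|A_ij|² = ‖A‖²_HS` for `A ≠ 0` (the Hilbert–Schmidt norm is a norm).
[cite: Chatterjee2016, §6 (‖M‖² = Σ|m_ij|² = tr(M*M))] -/
theorem re_trace_conjTranspose_mul_self_pos {A : Matrix n n ℂ} (hA : A ≠ 0) :
    0 < ((Aᴴ * A).trace).re := by
  have hps : (Aᴴ * A).PosSemidef := Matrix.posSemidef_conjTranspose_mul_self A
  have h0 : (0 : ℂ) ≤ (Aᴴ * A).trace := hps.trace_nonneg
  have hne : (Aᴴ * A).trace ≠ 0 := fun h => hA (Matrix.trace_conjTranspose_mul_self_eq_zero_iff.1 h)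
  obtain ⟨hre, him⟩ := Complex.nonneg_iff.1 h0
  rcases hre.lt_or_eq with hlt | heq
  · exact hlt
  · exact absurd (Complex.ext (by rw [Complex.zero_re]; exact heq.symm) (by rw [Complex.zero_im]; exact him.symm))
      hne

/-- **Chatterjee's Lemma 7.2**, norm-free: `N − Re tr U = ½ Re tr((1 − U)ᴴ(1 − U))` (`= ½‖1 − U‖²_HS`) for
`U ∈ U(N)`. [cite: Chatterjee2016, Lemma 7.2] -/
theorem card_sub_re_trace_eq {U : Matrix n n ℂ} (hU : U ∈ Matrix.unitaryGroup n ℂ) :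
    (Fintype.card n : ℝ) - (U.trace).re = (1 / 2) * (((1 - U)ᴴ * (1 - U)).trace).re := by
  have h1 : Uᴴ * U = 1 := by
    have := Matrix.mem_unitaryGroup_iff'.1 hU
    rwa [Matrix.star_eq_conjTranspose] at this
  have e : (1 - U)ᴴ * (1 - U) = 1 + 1 - Uᴴ - U := by
    rw [Matrix.conjTranspose_sub, Matrix.conjTranspose_one, sub_mul, mul_sub, mul_sub, h1, one_mul, one_mul,
      mul_one]
    abel
  rw [e, Matrix.trace_sub, Matrix.trace_sub, Matrix.trace_add, Matrix.trace_one, Matrix.trace_conjTranspose,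
    Complex.sub_re, Complex.sub_re, Complex.add_re, Complex.star_def, Complex.conj_re, Complex.natCast_re]
  ring

/-- `0 ≤ N − Re tr U` on `U(N)`. [cite: Chatterjee2016, Lemma 7.2] -/
theorem card_sub_re_trace_nonneg {U : Matrix n n ℂ} (hU : U ∈ Matrix.unitaryGroup n ℂ) :
    0 ≤ (Fintype.card n : ℝ) - (U.trace).re := by
  rw [card_sub_re_trace_eq hU]
  by_cases h : (1 - U) = 0
  · simp [h]
  · exact mul_nonneg (by norm_num) (re_trace_conjTranspose_mul_self_pos h).le

/-- **The one-plaquette cost has the unique minimiser `U = 1`**: `0 < N − Re tr U` for unitary `U ≠ 1`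
(`N − Re tr U = ½‖1 − U‖²_HS`). [cite: Chatterjee2016, Lemma 7.2] -/
theorem card_sub_re_trace_pos_of_ne_one {U : Matrix n n ℂ} (hU : U ∈ Matrix.unitaryGroup n ℂ) (h1 : U ≠ 1) :
    0 < (Fintype.card n : ℝ) - (U.trace).re := by
  rw [card_sub_re_trace_eq hU]
  have hne : (1 - U) ≠ 0 := sub_ne_zero.2 (Ne.symm h1)
  exact mul_pos (by norm_num) (re_trace_conjTranspose_mul_self_pos hne)

/-- At `U = 1` the cost vanishes: `N − Re tr 1 = 0`. [cite: Chatterjee2016, Lemma 7.2] -/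
theorem card_sub_re_trace_one : (Fintype.card n : ℝ) - ((1 : Matrix n n ℂ).trace).re = 0 := by
  rw [Matrix.trace_one, Complex.natCast_re, sub_self]

/-! ## §2 Calculus of `t ↦ tr e^{tX}`: first and second variations along one-parameter subgroups -/

/-- `d/du tr e^{uX} = tr(X e^{uX})` (`u ∈ ℂ`). [cite: Hall2015, Prop. 2.4 (d/dt e^{tX} = Xe^{tX})] -/
theorem hasDerivAt_trace_exp_smul (X : Matrix n n ℂ) (u : ℂ) :
    HasDerivAt (fun u : ℂ => (exp (u • X)).trace) ((X * exp (u • X)).trace) u :=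
  (LinearMap.toContinuousLinearMap (Matrix.traceLinearMap n ℂ ℂ)).hasFDerivAt.comp_hasDerivAt u
    (hasDerivAt_exp_smul_const' (𝕂 := ℂ) X u)

/-- `d/du tr(Y e^{uX}) = tr(Y X e^{uX})`. [cite: Hall2015, Prop. 2.4 (d/dt e^{tX} = Xe^{tX})] -/
theorem hasDerivAt_trace_mul_exp_smul (Y X : Matrix n n ℂ) (u : ℂ) :
    HasDerivAt (fun u : ℂ => (Y * exp (u • X)).trace) ((Y * (X * exp (u • X))).trace) u :=
  (LinearMap.toContinuousLinearMap (Matrix.traceLinearMap n ℂ ℂ)).hasFDerivAt.comp_hasDerivAt u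
    ((hasDerivAt_exp_smul_const' (𝕂 := ℂ) X u).const_mul Y)

/-- The real line `t ↦ c − Re tr e^{tX}` has derivative `−Re tr(X e^{tX})`. [cite: Hall2015, Prop. 2.4] -/
theorem hasDerivAt_const_sub_re_trace_exp (X : Matrix n n ℂ) (c t : ℝ) :
    HasDerivAt (fun t : ℝ => c - ((exp ((t : ℂ) • X)).trace).re) (-(((X * exp ((t : ℂ) • X)).trace).re)) t :=
  ((hasDerivAt_trace_exp_smul X t).real_of_complex).const_sub c

/-- **Line second variation of the one-plaquette cost**: `d²/dt²|₀ (c − Re tr e^{tX}) = −Re tr(X²)`.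
[cite: Chatterjee2016, Lemma 16.1 (e^{iH} = I + iH − H²/2 + O(‖H‖³))] [cite: Hall2015, Prop. 2.4] -/
theorem iteratedDeriv_two_const_sub_re_trace_exp (X : Matrix n n ℂ) (c : ℝ) :
    iteratedDeriv 2 (fun t : ℝ => c - ((exp ((t : ℂ) • X)).trace).re) 0 = -((X * X).trace).re := by
  have hderiv : deriv (fun t : ℝ => c - ((exp ((t : ℂ) • X)).trace).re) =
      fun t : ℝ => -(((X * exp ((t : ℂ) • X)).trace).re) :=
    funext fun t => (hasDerivAt_const_sub_re_trace_exp X c t).deriv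
  have hd2 : HasDerivAt (fun t : ℝ => -(((X * exp ((t : ℂ) • X)).trace).re))
      (-(((X * (X * exp (((0 : ℝ) : ℂ) • X))).trace).re)) 0 :=
    ((hasDerivAt_trace_mul_exp_smul X X ((0 : ℝ) : ℂ)).real_of_complex).neg
  rw [iteratedDeriv_succ, iteratedDeriv_one, hderiv, hd2.deriv, Complex.ofReal_zero, zero_smul, exp_zero, mul_one]

/-- For SKEW-HERMITIAN `X` the line second variation is the Hilbert–Schmidt norm:
`d²/dt²|₀ (c − Re tr e^{tX}) = Re tr(XᴴX) = ‖X‖²_HS`. [cite: Chatterjee2016, Lemma 16.1, §6] -/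
theorem iteratedDeriv_two_const_sub_re_trace_exp_of_skew {X : Matrix n n ℂ} (hX : Xᴴ = -X) (c : ℝ) :
    iteratedDeriv 2 (fun t : ℝ => c - ((exp ((t : ℂ) • X)).trace).re) 0 = ((Xᴴ * X).trace).re := by
  rw [iteratedDeriv_two_const_sub_re_trace_exp, hX, Matrix.neg_mul, Matrix.trace_neg, Complex.neg_re]

/-- Hence it is POSITIVE for skew-Hermitian `X ≠ 0`. [cite: Chatterjee2016, Lemma 16.1, §6] -/
theorem iteratedDeriv_two_const_sub_re_trace_exp_pos {X : Matrix n n ℂ} (hX : Xᴴ = -X) (hX0 : X ≠ 0) (c : ℝ) :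
    0 < iteratedDeriv 2 (fun t : ℝ => c - ((exp ((t : ℂ) • X)).trace).re) 0 := by
  rw [iteratedDeriv_two_const_sub_re_trace_exp_of_skew hX]
  exact re_trace_conjTranspose_mul_self_pos hX0

/-- `M ↦ Re tr e^{M}` is `C²` on `M_N(ℂ)` (indeed real-analytic: `exp` is given by an everywhere convergent power
series). [cite: Hall2015, Prop. 2.16] -/
theorem contDiff_re_trace_exp : ContDiff ℝ 2 (fun M : Matrix n n ℂ => ((exp M).trace).re) := by
  have hT : ContDiff ℂ 2 (fun M : Matrix n n ℂ => (exp M).trace) :=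
    (LinearMap.toContinuousLinearMap (Matrix.traceLinearMap n ℂ ℂ)).contDiff.comp
      (contDiff_iff_contDiffAt.2 fun M =>
        (NormedSpace.exp_analytic M : AnalyticAt ℂ (fun M : Matrix n n ℂ => exp M) M).contDiffAt)
  exact Complex.reCLM.contDiff.comp (hT.restrict_scalars ℝ)

/-! ## §3 Every log-charted closed subgroup of `U(N)`: the Wilson one-link weight concentrates at `1` -/

section General

variable {G : Type*} [Group G] [TopologicalSpace G] [IsTopologicalGroup G] [CompactSpace G]
  [MeasurableSpace G] [BorelSpace G]
variable {C : LogChart (Matrix n n ℂ)} {ρ : G →* Matrix n n ℂ}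

/-- ★ **The one-link Wilson weight concentrates at the identity.**  Let `G` be a compact group with a faithful
continuous representation `ρ` onto a log-charted closed subgroup of `U(N)` (`h : IsChartRep C ρ`, `ρ(G) ⊆ U(N)`,
`𝔤 = C.lie ⊆ 𝔲(N)` skew-Hermitian and `ad`-stable — `SU(N)`, `U(N)`, every closed subgroup of `U(N)` charted by
Bałaban's files), `μ` a Haar measure on `G`.  Then for every continuous `ψ : G → ℝ`,
`∫ e^{−β(N − Re tr ρ(g))} ψ(g) dμ ∕ ∫ e^{−β(N − Re tr ρ(g))} dμ ⟶ ψ(1)` as `β → ∞`: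
the Gibbs measures of the cost `N − Re tr ρ(g)` (unique minimum `g = 1`, Lemma 7.2; `C²` with line second variation
`‖X‖²_HS > 0` in exponential coordinates) converge weakly to `δ_1`.
[cite: Hwang1980, main theorem (one-point minimum set)] [cite: Chatterjee2016, Lemma 7.2]
[cite: Breitung1994, Thm 41 p. 56] [cite: Helgason2000, Ch. I §1 Thm 1.14 (13) p. 96] -/
theorem tendsto_gibbs_expectation_wilsonLink (h : IsChartRep C ρ) [FiniteDimensional ℝ C.lie]
    (hlie : ∀ x ∈ C.lie, ∀ y ∈ C.lie, x * y - y * x ∈ C.lie)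
    (hU : ∀ g, ρ g ∈ Matrix.unitaryGroup n ℂ) (hsk : ∀ X ∈ C.lie, star X = -X)
    (μ : Measure G) [μ.IsHaarMeasure] {ψ : G → ℝ} (hψ : Continuous ψ) :
    Tendsto (fun β : ℝ =>
      (∫ g, Real.exp (-β * ((Fintype.card n : ℝ) - ((ρ g).trace).re)) * ψ g ∂μ) /
        ∫ g, Real.exp (-β * ((Fintype.card n : ℝ) - ((ρ g).trace).re)) ∂μ) atTop (𝓝 (ψ 1)) := by
  -- Borel structure on `𝔤` and a Euclidean frame `e : ℝ^d ≃L 𝔤`.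
  letI : MeasurableSpace C.lie := borel _
  haveI : BorelSpace C.lie := ⟨rfl⟩
  obtain ⟨d, hd⟩ : ∃ d : ℕ, Module.finrank ℝ C.lie = d := ⟨_, rfl⟩
  let e : EuclideanSpace ℝ (Fin d) ≃L[ℝ] C.lie :=
    ContinuousLinearEquiv.ofFinrankEq (by rw [finrank_euclideanSpace_fin, hd])
  -- the cost and its three Laplace hypotheses
  set f : G → ℝ := fun g => (Fintype.card n : ℝ) - ((ρ g).trace).re with hf_def
  have hf : Continuous f :=
    continuous_const.sub (Complex.continuous_re.comp (h.continuous.matrix_trace))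
  have hmin : ∀ g, g ≠ 1 → f 1 < f g := by
    intro g hg
    have hρ : ρ g ≠ 1 := fun h' => hg (h.injective (by rw [h', map_one]))
    have h0 : f 1 = 0 := by simp only [hf_def, map_one, card_sub_re_trace_one]
    rw [h0]
    exact card_sub_re_trace_pos_of_ne_one (hU g) hρ
  have hF : ContDiffAt ℝ 2 (fun v : EuclideanSpace ℝ (Fin d) => f (1 * h.expChart (e v))) 0 := by
    have hfun : (fun v : EuclideanSpace ℝ (Fin d) => f (1 * h.expChart (e v))) =
        fun v => (Fintype.card n : ℝ) - ((exp ((e v : C.lie) : Matrix n n ℂ)).trace).re := by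
      funext v
      simp only [hf_def, one_mul, IsChartRep.rho_expChart]
    rw [hfun]
    have hlin : ContDiff ℝ 2 (fun v : EuclideanSpace ℝ (Fin d) => ((e v : C.lie) : Matrix n n ℂ)) :=
      (C.lie.subtypeL.comp (e : EuclideanSpace ℝ (Fin d) →L[ℝ] C.lie)).contDiff
    exact ((contDiff_const.sub contDiff_re_trace_exp).comp hlin).contDiffAt
  have hline : ∀ v : EuclideanSpace ℝ (Fin d), v ≠ 0 →
      0 < iteratedDeriv 2 (fun t : ℝ => f (1 * h.expChart (e (t • v)))) 0 := by
    intro v hv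
    set X : Matrix n n ℂ := ((e v : C.lie) : Matrix n n ℂ) with hXdef
    have hX0 : X ≠ 0 := by
      intro h0
      apply hv
      have h1 : (e v : C.lie) = 0 := by
        ext1
        rw [← hXdef, h0, Submodule.coe_zero]
      exact e.map_eq_zero_iff.1 h1
    have hsk' : Xᴴ = -X := by
      rw [← Matrix.star_eq_conjTranspose]
      exact hsk _ (e v).2
    have hfun : (fun t : ℝ => f (1 * h.expChart (e (t • v)))) =
        fun t : ℝ => (Fintype.card n : ℝ) - ((exp ((t : ℂ) • X)).trace).re := by
      funext t
      simp only [hf_def, one_mul, IsChartRep.rho_expChart, map_smul, Submodule.coe_smul, hXdef]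
      rfl
    rw [hfun]
    exact iteratedDeriv_two_const_sub_re_trace_exp_pos hsk' hX0 _
  exact tendsto_gibbs_expectation_haar_of_contDiffAt h hlie μ e hf hψ hmin hF hline

end General

/-! ## §4 `SU(N)` and `U(N)`, every rank -/

section Classical

/-- ★ **`SU(N)`, every `N ≥ 1`: the one-link ∕ one-plaquette law `e^{−β(N − Re tr U)} dU ∕ Z_β` concentrates at
`U = 1` as `β → ∞`** — `⟨ψ⟩_β → ψ(1)` for every continuous `ψ` and every Haar measure on `SU(N)` (the `β = 1∕g₀² → ∞`
limit of the single-plaquette model). [cite: Hwang1980, main theorem (one-point minimum set)]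
[cite: Chatterjee2016, Lemma 7.2] [cite: Helgason2000, Ch. I §1 Thm 1.14 (13) p. 96] -/
theorem tendsto_gibbs_expectation_wilsonLink_specialUnitaryGroup [Nonempty n]
    (μ : Measure (Matrix.specialUnitaryGroup n ℂ)) [μ.IsHaarMeasure]
    {ψ : Matrix.specialUnitaryGroup n ℂ → ℝ} (hψ : Continuous ψ) :
    Tendsto (fun β : ℝ =>
      (∫ U, Real.exp (-β * ((Fintype.card n : ℝ) - ((U : Matrix n n ℂ).trace).re)) * ψ U ∂μ) /
        ∫ U, Real.exp (-β * ((Fintype.card n : ℝ) - ((U : Matrix n n ℂ).trace).re)) ∂μ) atTop (𝓝 (ψ 1)) := by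
  have hU : ∀ U : Matrix.specialUnitaryGroup n ℂ, fundamentalRep n U ∈ Matrix.unitaryGroup n ℂ := fun U =>
    (Matrix.mem_specialUnitaryGroup_iff.1 U.2).1
  have hsk : ∀ X ∈ (specialUnitaryLogChart n).lie, star X = -X := fun X hX =>
    (mem_specialUnitaryLogChart_lie.1 hX).1
  simpa only [fundamentalRep_apply] using
    tendsto_gibbs_expectation_wilsonLink (isChartRep_specialUnitaryGroup (n := n))
      (lie_adStable_specialUnitaryGroup (n := n)) hU hsk μ hψ

/-- ★ **`U(N)`: the one-link law `e^{−β(N − Re tr U)} dU ∕ Z_β` concentrates at `U = 1` as `β → ∞`** (Chatterjee's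
setting, `φ(U) = Re tr(I − U)` on `U(N)`). [cite: Hwang1980, main theorem (one-point minimum set)]
[cite: Chatterjee2016, (2.1), Lemma 7.2] [cite: Helgason2000, Ch. I §1 Thm 1.14 (13) p. 96] -/
theorem tendsto_gibbs_expectation_wilsonLink_unitaryGroup
    (μ : Measure (Matrix.unitaryGroup n ℂ)) [μ.IsHaarMeasure]
    {ψ : Matrix.unitaryGroup n ℂ → ℝ} (hψ : Continuous ψ) :
    Tendsto (fun β : ℝ =>
      (∫ U, Real.exp (-β * ((Fintype.card n : ℝ) - ((U : Matrix n n ℂ).trace).re)) * ψ U ∂μ) /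
        ∫ U, Real.exp (-β * ((Fintype.card n : ℝ) - ((U : Matrix n n ℂ).trace).re)) ∂μ) atTop (𝓝 (ψ 1)) := by
  have hU : ∀ U : Matrix.unitaryGroup n ℂ, unitaryFundamentalRep n ℂ U ∈ Matrix.unitaryGroup n ℂ := fun U => U.2
  have hsk : ∀ X ∈ (unitaryLogChart n).lie, star X = -X := fun X hX => mem_unitaryLogChart_lie.1 hX
  simpa only [unitaryFundamentalRep_apply] using
    tendsto_gibbs_expectation_wilsonLink (isChartRep_unitaryGroup (n := n))
      (lie_adStable_unitaryGroup (n := n)) hU hsk μ hψ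

end Classical

end Literature.MathematicalPhysics.QuantumFieldTheory.OneLinkWeakCoupling
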